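import Summits.ValiantsHypothesis.ValiantsHypothesis.Theorems.KPlusLogSqLawTropicalBMarkedEdgeCoreQWitness
import Summits.ValiantsHypothesis.ValiantsHypothesis.Theorems.KPlusLogSqLawTropicalBMarkedEdgeCoreQPairs
import Summits.ValiantsHypothesis.ValiantsHypothesis.Theorems.KPlusLogSqLawTropicalBMarkedEdgeCoreZUnique

/-!
# Route «KPlusLogSqLaw», crux `TropicalB` (stmt-ValiantsHypothesis-19771) — MARKED-EDGE sector, NESTED-TRIANGLE CORE, ALL sizes:
# the Q-COVER THEOREM (g18's «S3*»), part C2 — assembly: `s3star` (four permutations) and `core_Q_exists` (any realisation)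

HONEST FRAMING.  Helper file (cell `pub-symmetroid`, seat val-sym-trop-p4 (g19), 2026-08-29; `--supports stmt-ValiantsHypothesis-19771 --as
helper`).  Assembles parts A (`…CoreQTrunk`), B1/B2 (`…CoreQHall`, `…CoreQWitness`), C1 (`…CoreQPairs`) with g18's kernel lemmas
(`core_BC/BE/CE_isCycle`, p669751; `core_BCZ/BEZ/CEZ_unique`, p670108).  This PROVES g18's located sub-claim **S3\*** (memo ALLM-STRUCTURE-g18
§4b, S3STAR-PROBLEM.md; exhaustive m ≤ 7 and 0 violators to m = 20 there) for EVERY finite node set; the all-m nested-triangle law then needs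
only the located P-completion (memo §4f).  Nothing here proves the law; nothing concerns `TropicalB` in its window, `WeakLifting`, the doors,
`MatrixDescartes` (stmt-ValiantsHypothesis-18050) or VP ≠ VNP.

**THEOREM `s3star` (relative coordinates).**  Three permutations `α, γ, ε` of a finite set, gates `b0 ≠ b4`, marked arcs
`α b1 = γ b1 = z1 ≠ ε b1`, `α b2 = ε b2 = z2 ≠ γ b2`, `γ b3 = ε b3 = z3 ≠ α b3` (the `b`'s, `z`'s off the gates, `bₗ ≠ zₗ`, distinct as
stated), all three colours moving `b0`; if `α⁻¹γ, α⁻¹ε, γ⁻¹ε` are cycles and every cover inside each pair-union fixing both gates is trivial,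
then a Q-COVER exists for some pair: `ρ` inside `α ∪ γ ∪ id` with `ρ b4 = b4, ρ b1 = z1, ρ b0 ≠ b0`, or the `(α,ε;b2)` / `(γ,ε;b3)` analogue.
PROOF.  Part B2 gives each pair a Q-cover or an A1- or A2-witness; part A's trunk dichotomy (the only use of the single-cycle hypotheses) turns a
witness into a label, class X (`T ∨ coT'`) or class Y (`coT ∨ T'`); part C1: two pairs sharing a colour are never in the same class; the three
pairs pairwise share a colour — pigeonhole.

**THEOREM `core_Q_exists` (the kernel target named by g18).**  In any realisation of the nested-triangle core (setting of the Core files: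
unique maximisers `σB, σC, σE, σZ` with marked fixed points exactly {b1,b2}, {b1,b3}, {b2,b3}, {b0,b4}) there is a cover `T` inside
`σB ⊎ σC ⊎ σZ` with `T b4 = b4, T b1 = b1, T b0 ≠ b0`, or inside `σB ⊎ σE ⊎ σZ` with `T b4 = b4, T b2 = b2, T b0 ≠ b0`, or inside `σC ⊎ σE ⊎ σZ`
with `T b4 = b4, T b3 = b3, T b0 ≠ b0` (the last is then excluded by b4-rigidity `core_CEZ_four`, p670756, giving g18's S3).
-/

set_option linter.dupNamespace false
set_option autoImplicit false

namespace Summit.ValiantsHypothesis.ValiantsHypothesis.Theorems.KPlusLogSqLaw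
namespace MarkedEdge
namespace Core
namespace QCover

open Finset

variable {V : Type*} [Fintype V] [DecidableEq V]

/-- **Label of a witness.**  For a pair `(ξ,η)` at `b ↦ z` with `ξ⁻¹η` a cycle, an A1- or A2-witness yields class X (forward trunk, or a
backward co-trunk containing the prescribed heads `q₁, q₂`) or class Y (forward co-trunk containing the prescribed tails `p₁, p₂`, or backward
trunk). [this seat's lemma] -/
theorem label_of_witness (ξ η : Equiv.Perm V) (t s b z p₁ p₂ q₁ q₂ : V) (hξb : ξ b = z) (hηb : η b = z)
    (H1 : (ξ⁻¹ * η).IsCycle) (hp₁ : ξ p₁ ≠ η p₁) (hp₂ : ξ p₂ ≠ η p₂) (hp₁s : p₁ ≠ s) (hp₂s : p₂ ≠ s)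
    (hq₁ : ξ⁻¹ q₁ ≠ η⁻¹ q₁) (hq₂ : ξ⁻¹ q₂ ≠ η⁻¹ q₂) (hq₁s : q₁ ≠ s) (hq₂s : q₂ ≠ s)
    (hW : (∃ F : Finset V, b ∈ F ∧ z ∉ F ∧ t ∉ F ∧ s ∉ F ∧
        (∀ u, ξ u ∈ F → u ∈ F ∨ u = s) ∧ (∀ u, η u ∈ F → u ∈ F ∨ u = s)) ∨
      (∃ B : Finset V, z ∈ B ∧ b ∉ B ∧ t ∉ B ∧ s ∉ B ∧
        (∀ u ∈ B, ξ u ∈ B ∨ ξ u = s) ∧ (∀ u ∈ B, η u ∈ B ∨ η u = s))) :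
    ((∃ n, (∀ i, i ≤ n + 1 → (ξ ^ i) s = (η ^ i) s) ∧ (ξ ^ n) s = b ∧ (ξ ^ (n + 1)) s = z) ∨
      (∃ B : Finset V, z ∈ B ∧ b ∉ B ∧ s ∉ B ∧ (∀ u ∈ B, ξ u ∈ B ∨ ξ u = s) ∧ (∀ u ∈ B, η u ∈ B ∨ η u = s) ∧
        q₁ ∈ B ∧ q₂ ∈ B)) ∨
    ((∃ F : Finset V, b ∈ F ∧ z ∉ F ∧ s ∉ F ∧ (∀ u, ξ u ∈ F → u ∈ F ∨ u = s) ∧ (∀ u, η u ∈ F → u ∈ F ∨ u = s) ∧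
        p₁ ∈ F ∧ p₂ ∈ F) ∨
      (∃ n, (∀ i, i ≤ n + 1 → (ξ⁻¹ ^ i) s = (η⁻¹ ^ i) s) ∧ (ξ⁻¹ ^ n) s = z ∧ (ξ⁻¹ ^ (n + 1)) s = b)) := by
  rcases hW with ⟨F, hbF, hzF, -, hsF, hclξ, hclη⟩ | ⟨B, hzB, hbB, -, hsB, hclξ, hclη⟩
  · rcases trunk_dichotomy ξ η F s b z p₁ p₂ hbF hzF hsF hξb hηb hclξ hclη H1 hp₁ hp₂ hp₁s hp₂s with h | h
    · exact Or.inl (Or.inl h)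
    · exact Or.inr (Or.inl ⟨F, hbF, hzF, hsF, hclξ, hclη, h⟩)
  · have hξ' : ξ⁻¹ z = b := by rw [Equiv.Perm.inv_eq_iff_eq, hξb]
    have hη' : η⁻¹ z = b := by rw [Equiv.Perm.inv_eq_iff_eq, hηb]
    have hpξ : ∀ u, ξ⁻¹ u ∈ B → u ∈ B ∨ u = s := fun u hu => by
      rcases hclξ _ hu with h | h
      · left; simpa using h
      · right; simpa using h
    have hpη : ∀ u, η⁻¹ u ∈ B → u ∈ B ∨ u = s := fun u hu => by
      rcases hclη _ hu with h | h
      · left; simpa using h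
      · right; simpa using h
    have hq₁' : ξ⁻¹ q₁ ≠ η⁻¹ q₁ := hq₁
    rcases trunk_dichotomy ξ⁻¹ η⁻¹ B s z b q₁ q₂ hzB hbB hsB hξ' hη' hpξ hpη (isCycle_dual ξ η H1)
      hq₁' hq₂ hq₁s hq₂s with h | h
    · exact Or.inr (Or.inr h)
    · exact Or.inl (Or.inr ⟨B, hzB, hbB, hsB, hclξ, hclη, h⟩)

/-- **S3\* (relative coordinates).**  See the module docstring. [this seat's theorem] -/
theorem s3star (α γ ε : Equiv.Perm V) (b0 b4 b1 b2 b3 z1 z2 z3 : V)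
    (ha1 : α b1 = z1) (hc1 : γ b1 = z1) (he1 : ε b1 ≠ z1)
    (ha2 : α b2 = z2) (he2 : ε b2 = z2) (hc2 : γ b2 ≠ z2)
    (hc3 : γ b3 = z3) (he3 : ε b3 = z3) (ha3 : α b3 ≠ z3)
    (ha0 : α b0 ≠ b0) (hc0 : γ b0 ≠ b0) (he0 : ε b0 ≠ b0) (h04 : b0 ≠ b4)
    (h10 : b1 ≠ b0) (h14 : b1 ≠ b4) (h20 : b2 ≠ b0) (h24 : b2 ≠ b4) (h30 : b3 ≠ b0) (h34 : b3 ≠ b4)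
    (hz10 : z1 ≠ b0) (hz14 : z1 ≠ b4) (hz20 : z2 ≠ b0) (hz24 : z2 ≠ b4) (hz30 : z3 ≠ b0) (hz34 : z3 ≠ b4)
    (h12 : b1 ≠ b2) (h13 : b1 ≠ b3) (h23 : b2 ≠ b3) (hz12 : z1 ≠ z2) (hz13 : z1 ≠ z3) (hz23 : z2 ≠ z3)
    (hbz1 : b1 ≠ z1) (hbz2 : b2 ≠ z2) (hbz3 : b3 ≠ z3)
    (H1a : (α⁻¹ * γ).IsCycle) (H1b : (α⁻¹ * ε).IsCycle) (H1c : (γ⁻¹ * ε).IsCycle)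
    (H2a : ∀ ρ : Equiv.Perm V, (∀ i, ρ i = i ∨ ρ i = α i ∨ ρ i = γ i) → ρ b0 = b0 → ρ b4 = b4 → ρ = 1)
    (H2b : ∀ ρ : Equiv.Perm V, (∀ i, ρ i = i ∨ ρ i = α i ∨ ρ i = ε i) → ρ b0 = b0 → ρ b4 = b4 → ρ = 1)
    (H2c : ∀ ρ : Equiv.Perm V, (∀ i, ρ i = i ∨ ρ i = γ i ∨ ρ i = ε i) → ρ b0 = b0 → ρ b4 = b4 → ρ = 1) :
    (∃ ρ : Equiv.Perm V, (∀ i, ρ i = i ∨ ρ i = α i ∨ ρ i = γ i) ∧ ρ b4 = b4 ∧ ρ b1 = z1 ∧ ρ b0 ≠ b0) ∨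
    (∃ ρ : Equiv.Perm V, (∀ i, ρ i = i ∨ ρ i = α i ∨ ρ i = ε i) ∧ ρ b4 = b4 ∧ ρ b2 = z2 ∧ ρ b0 ≠ b0) ∨
    (∃ ρ : Equiv.Perm V, (∀ i, ρ i = i ∨ ρ i = γ i ∨ ρ i = ε i) ∧ ρ b4 = b4 ∧ ρ b3 = z3 ∧ ρ b0 ≠ b0) := by
  -- moved points for the trunk dichotomies
  have m12 : α b2 ≠ γ b2 := by rw [ha2]; exact fun h => hc2 h.symm
  have m13 : α b3 ≠ γ b3 := by rw [hc3]; exact ha3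
  have m21 : α b1 ≠ ε b1 := by rw [ha1]; exact fun h => he1 h.symm
  have m23 : α b3 ≠ ε b3 := by rw [he3]; exact ha3
  have m31 : γ b1 ≠ ε b1 := by rw [hc1]; exact fun h => he1 h.symm
  have m32 : γ b2 ≠ ε b2 := by rw [he2]; exact hc2
  have n12 : α⁻¹ z2 ≠ γ⁻¹ z2 := by
    rw [show α⁻¹ z2 = b2 by rw [Equiv.Perm.inv_eq_iff_eq, ha2], ne_eq, eq_comm, Equiv.Perm.inv_eq_iff_eq]
    exact fun h => hc2 h.symm
  have n13 : α⁻¹ z3 ≠ γ⁻¹ z3 := by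
    rw [show γ⁻¹ z3 = b3 by rw [Equiv.Perm.inv_eq_iff_eq, hc3], ne_eq, Equiv.Perm.inv_eq_iff_eq]
    exact fun h => ha3 h.symm
  have n21 : α⁻¹ z1 ≠ ε⁻¹ z1 := by
    rw [show α⁻¹ z1 = b1 by rw [Equiv.Perm.inv_eq_iff_eq, ha1], ne_eq, eq_comm, Equiv.Perm.inv_eq_iff_eq]
    exact fun h => he1 h.symm
  have n23 : α⁻¹ z3 ≠ ε⁻¹ z3 := by
    rw [show ε⁻¹ z3 = b3 by rw [Equiv.Perm.inv_eq_iff_eq, he3], ne_eq, Equiv.Perm.inv_eq_iff_eq]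
    exact fun h => ha3 h.symm
  have n31 : γ⁻¹ z1 ≠ ε⁻¹ z1 := by
    rw [show γ⁻¹ z1 = b1 by rw [Equiv.Perm.inv_eq_iff_eq, hc1], ne_eq, eq_comm, Equiv.Perm.inv_eq_iff_eq]
    exact fun h => he1 h.symm
  have n32 : γ⁻¹ z2 ≠ ε⁻¹ z2 := by
    rw [show ε⁻¹ z2 = b2 by rw [Equiv.Perm.inv_eq_iff_eq, he2], ne_eq, Equiv.Perm.inv_eq_iff_eq]
    exact fun h => hc2 h.symm
  -- pair trichotomies
  rcases cover_or_witness α γ b0 b4 b1 z1 ha1 hc1 ha0 hc0 h04 h10 h14 hz10 hz14 hbz1 H2a with Q | hW1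
  · exact Or.inl Q
  rcases cover_or_witness α ε b0 b4 b2 z2 ha2 he2 ha0 he0 h04 h20 h24 hz20 hz24 hbz2 H2b with Q | hW2
  · exact Or.inr (Or.inl Q)
  rcases cover_or_witness γ ε b0 b4 b3 z3 hc3 he3 hc0 he0 h04 h30 h34 hz30 hz34 hbz3 H2c with Q | hW3
  · exact Or.inr (Or.inr Q)
  exfalso
  -- labels
  have L1 := label_of_witness α γ b0 b4 b1 z1 b2 b3 z2 z3 ha1 hc1 H1a m12 m13 h24 h34 n12 n13 hz24 hz34 hW1
  have L2 := label_of_witness α ε b0 b4 b2 z2 b1 b3 z1 z3 ha2 he2 H1b m21 m23 h14 h34 n21 n23 hz14 hz34 hW2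
  have L3 := label_of_witness γ ε b0 b4 b3 z3 b1 b2 z1 z2 hc3 he3 H1c m31 m32 h14 h24 n31 n32 hz14 hz24 hW3
  -- pigeonhole over the two classes
  rcases L1 with x1 | y1 <;> rcases L2 with x2 | y2 <;> rcases L3 with x3 | y3
  · -- X X _
    exact classX_pair_false α γ ε b4 b1 z1 b2 z2 ha1 he1 ha2 hc2 h12 hz12 h14 h24
      (x1.imp id fun ⟨B, hz, hb, hs, hα, _, hq, _⟩ => ⟨B, hz, hb, hs, hα, hq⟩)
      (x2.imp id fun ⟨B, hz, hb, hs, hα, _, hq, _⟩ => ⟨B, hz, hb, hs, hα, hq⟩)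
  · exact classX_pair_false α γ ε b4 b1 z1 b2 z2 ha1 he1 ha2 hc2 h12 hz12 h14 h24
      (x1.imp id fun ⟨B, hz, hb, hs, hα, _, hq, _⟩ => ⟨B, hz, hb, hs, hα, hq⟩)
      (x2.imp id fun ⟨B, hz, hb, hs, hα, _, hq, _⟩ => ⟨B, hz, hb, hs, hα, hq⟩)
  · -- X Y X : pairs 1,3 share γ
    exact classX_pair_false γ α ε b4 b1 z1 b3 z3 hc1 he1 hc3 ha3 h13 hz13 h14 h34
      (x1.imp (fun ⟨n, h⟩ => ⟨n, trunk_symm α γ b4 b1 z1 n h.1 h.2.1 h.2.2⟩)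
        fun ⟨B, hz, hb, hs, _, hγ, _, hq⟩ => ⟨B, hz, hb, hs, hγ, hq⟩)
      (x3.imp id fun ⟨B, hz, hb, hs, hγ, _, hq, _⟩ => ⟨B, hz, hb, hs, hγ, hq⟩)
  · -- X Y Y : pairs 2,3 share ε
    exact classY_pair_false ε α γ b4 b2 z2 b3 z3 he2 hc2 he3 ha3 h23 hz23 hz24 hz34
      (y2.imp (fun ⟨F, hb, hz, hs, _, hε, _, hp⟩ => ⟨F, hb, hz, hs, hε, hp⟩)
        fun ⟨n, h⟩ => ⟨n, trunk_symm α⁻¹ ε⁻¹ b4 z2 b2 n h.1 h.2.1 h.2.2⟩)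
      (y3.imp (fun ⟨F, hb, hz, hs, _, hε, _, hp⟩ => ⟨F, hb, hz, hs, hε, hp⟩)
        fun ⟨n, h⟩ => ⟨n, trunk_symm γ⁻¹ ε⁻¹ b4 z3 b3 n h.1 h.2.1 h.2.2⟩)
  · -- Y X X : pairs 2,3 share ε
    exact classX_pair_false ε α γ b4 b2 z2 b3 z3 he2 hc2 he3 ha3 h23 hz23 h24 h34
      (x2.imp (fun ⟨n, h⟩ => ⟨n, trunk_symm α ε b4 b2 z2 n h.1 h.2.1 h.2.2⟩)
        fun ⟨B, hz, hb, hs, _, hε, _, hq⟩ => ⟨B, hz, hb, hs, hε, hq⟩)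
      (x3.imp (fun ⟨n, h⟩ => ⟨n, trunk_symm γ ε b4 b3 z3 n h.1 h.2.1 h.2.2⟩)
        fun ⟨B, hz, hb, hs, _, hε, _, hq⟩ => ⟨B, hz, hb, hs, hε, hq⟩)
  · -- Y X Y : pairs 1,3 share γ
    exact classY_pair_false γ α ε b4 b1 z1 b3 z3 hc1 he1 hc3 ha3 h13 hz13 hz14 hz34
      (y1.imp (fun ⟨F, hb, hz, hs, _, hγ, _, hp⟩ => ⟨F, hb, hz, hs, hγ, hp⟩)
        fun ⟨n, h⟩ => ⟨n, trunk_symm α⁻¹ γ⁻¹ b4 z1 b1 n h.1 h.2.1 h.2.2⟩)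
      (y3.imp (fun ⟨F, hb, hz, hs, hγ, _, hp, _⟩ => ⟨F, hb, hz, hs, hγ, hp⟩) id)
  · -- Y Y _
    exact classY_pair_false α γ ε b4 b1 z1 b2 z2 ha1 he1 ha2 hc2 h12 hz12 hz14 hz24
      (y1.imp (fun ⟨F, hb, hz, hs, hα, _, hp, _⟩ => ⟨F, hb, hz, hs, hα, hp⟩) id)
      (y2.imp (fun ⟨F, hb, hz, hs, hα, _, hp, _⟩ => ⟨F, hb, hz, hs, hα, hp⟩) id)
  · exact classY_pair_false α γ ε b4 b1 z1 b2 z2 ha1 he1 ha2 hc2 h12 hz12 hz14 hz24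
      (y1.imp (fun ⟨F, hb, hz, hs, hα, _, hp, _⟩ => ⟨F, hb, hz, hs, hα, hp⟩) id)
      (y2.imp (fun ⟨F, hb, hz, hs, hα, _, hp, _⟩ => ⟨F, hb, hz, hs, hα, hp⟩) id)

end QCover

/-! ### The kernel target: a Q-cover exists in every realisation -/

section Core

variable {V : Type*} [Fintype V] [DecidableEq V]
variable (ok : V → V → Prop) (w g : V → V → ℤ) (b : Fin 5 → V)

/-- **`core_Q_exists`.**  In any realisation of the nested-triangle core {1,2},{1,3},{2,3},{0,4} (any finite `V`), one of the three
pairs `(B,C)`, `(B,E)`, `(C,E)` admits a Q-cover: a cover inside its union with `σZ` using the loop at `b4` and the pair's common marked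
loop, and not the loop at `b0`.  (g18's located S3\*; the `(C,E)` case is excluded afterwards by `core_CEZ_four`.) [this seat's theorem] -/
theorem core_Q_exists (hb : Function.Injective b)
    (hoff : ∀ i j, j ≠ i → g i j = 0) (hmark : ∀ l, g (b l) (b l) = (2 : ℤ) ^ (l : ℕ)) (haux : ∀ i, (∀ l, b l ≠ i) → g i i = 0)
    {θB θC θE θZ : ℤ} {σB σC σE σZ : Equiv.Perm V}
    (hB : (∀ i, ok i (σB i)) ∧ ∀ τ : Equiv.Perm V, τ ≠ σB → (∀ i, ok i (τ i)) →
      ∑ i, (w i (τ i) + θB * g i (τ i)) < ∑ i, (w i (σB i) + θB * g i (σB i)))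
    (hC : (∀ i, ok i (σC i)) ∧ ∀ τ : Equiv.Perm V, τ ≠ σC → (∀ i, ok i (τ i)) →
      ∑ i, (w i (τ i) + θC * g i (τ i)) < ∑ i, (w i (σC i) + θC * g i (σC i)))
    (hE : (∀ i, ok i (σE i)) ∧ ∀ τ : Equiv.Perm V, τ ≠ σE → (∀ i, ok i (τ i)) →
      ∑ i, (w i (τ i) + θE * g i (τ i)) < ∑ i, (w i (σE i) + θE * g i (σE i)))
    (hZ : (∀ i, ok i (σZ i)) ∧ ∀ τ : Equiv.Perm V, τ ≠ σZ → (∀ i, ok i (τ i)) →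
      ∑ i, (w i (τ i) + θZ * g i (τ i)) < ∑ i, (w i (σZ i) + θZ * g i (σZ i)))
    (hB0 : σB (b 0) ≠ b 0) (hB1 : σB (b 1) = b 1) (hB2 : σB (b 2) = b 2) (hB3 : σB (b 3) ≠ b 3) (hB4 : σB (b 4) ≠ b 4)
    (hC0 : σC (b 0) ≠ b 0) (hC1 : σC (b 1) = b 1) (hC2 : σC (b 2) ≠ b 2) (hC3 : σC (b 3) = b 3) (hC4 : σC (b 4) ≠ b 4)
    (hE0 : σE (b 0) ≠ b 0) (hE1 : σE (b 1) ≠ b 1) (hE2 : σE (b 2) = b 2) (hE3 : σE (b 3) = b 3) (hE4 : σE (b 4) ≠ b 4)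
    (hZ0 : σZ (b 0) = b 0) (hZ1 : σZ (b 1) ≠ b 1) (hZ2 : σZ (b 2) ≠ b 2) (hZ3 : σZ (b 3) ≠ b 3) (hZ4 : σZ (b 4) = b 4) :
    (∃ T : Equiv.Perm V, (∀ i, T i = σB i ∨ T i = σC i ∨ T i = σZ i) ∧ T (b 4) = b 4 ∧ T (b 1) = b 1 ∧ T (b 0) ≠ b 0) ∨
    (∃ T : Equiv.Perm V, (∀ i, T i = σB i ∨ T i = σE i ∨ T i = σZ i) ∧ T (b 4) = b 4 ∧ T (b 2) = b 2 ∧ T (b 0) ≠ b 0) ∨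
    (∃ T : Equiv.Perm V, (∀ i, T i = σC i ∨ T i = σE i ∨ T i = σZ i) ∧ T (b 4) = b 4 ∧ T (b 3) = b 3 ∧ T (b 0) ≠ b 0) := by
  obtain ⟨hBC, hCE, hEZ⟩ := theta_order ok w g b hb hoff hmark haux hB hC hE hZ hB0 hB1 hB2 hB3 hB4 hC0 hC1 hC2 hC3 hC4
    hE0 hE1 hE2 hE3 hE4 hZ0 hZ1 hZ2 hZ3 hZ4
  have iBC := core_BC_isCycle ok w g b hb hoff hmark haux hBC hB hC hB0 hB1 hB2 hB3 hB4 hC0 hC1 hC2 hC3 hC4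
  have iBE := core_BE_isCycle ok w g b hb hoff hmark haux (hBC.trans hCE) hB hE hB0 hB1 hB2 hB3 hB4 hE0 hE1 hE2 hE3 hE4
  have iCE := core_CE_isCycle ok w g b hb hoff hmark haux hCE hC hE hC0 hC1 hC2 hC3 hC4 hE0 hE1 hE2 hE3 hE4
  have uBC := core_BCZ_unique ok w g b hb hoff hmark haux hBC (hCE.trans hEZ) hB hC hZ hB0 hB1 hB2 hB3 hB4 hC0 hC1 hC2 hC3
    hC4 hZ0 hZ1 hZ2 hZ3 hZ4
  have uBE := core_BEZ_unique ok w g b hb hoff hmark haux (hBC.trans hCE) hEZ hB hE hZ hB0 hB1 hB2 hB3 hB4 hE0 hE1 hE2 hE3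
    hE4 hZ0 hZ1 hZ2 hZ3 hZ4
  have uCE := core_CEZ_unique ok w g b hb hoff hmark haux hCE hEZ hC hE hZ hC0 hC1 hC2 hC3 hC4 hE0 hE1 hE2 hE3 hE4 hZ0 hZ1
    hZ2 hZ3 hZ4
  -- relative coordinates
  set α := σZ⁻¹ * σB with hα
  set γ := σZ⁻¹ * σC with hγ
  set ε := σZ⁻¹ * σE with hε
  have rel : ∀ (σX : Equiv.Perm V) (i : V), (σZ⁻¹ * σX) i = σZ⁻¹ (σX i) := fun _ _ => rfl
  have hinv : ∀ (σX σY : Equiv.Perm V), (σZ⁻¹ * σX)⁻¹ * (σZ⁻¹ * σY) = σX⁻¹ * σY := fun σX σY => by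
    rw [mul_inv_rev, inv_inv, mul_assoc, mul_inv_cancel_left]
  -- Z-rigidity in relative form
  have rigid : ∀ σX σY : Equiv.Perm V,
      (∀ T : Equiv.Perm V, (∀ i, T i = σX i ∨ T i = σY i ∨ T i = σZ i) → T (b 0) = b 0 → T (b 4) = b 4 → T = σZ) →
      ∀ ρ : Equiv.Perm V, (∀ i, ρ i = i ∨ ρ i = (σZ⁻¹ * σX) i ∨ ρ i = (σZ⁻¹ * σY) i) → ρ (b 0) = b 0 → ρ (b 4) = b 4 →
        ρ = 1 := by
    intro σX σY hU ρ hρ h0 h4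
    have key := hU (σZ * ρ) (fun i => by
        rcases hρ i with h | h | h
        · right; right; rw [Equiv.Perm.mul_apply, h]
        · left; rw [Equiv.Perm.mul_apply, h, rel]; simp
        · right; left; rw [Equiv.Perm.mul_apply, h, rel]; simp)
      (by rw [Equiv.Perm.mul_apply, h0, hZ0]) (by rw [Equiv.Perm.mul_apply, h4, hZ4])
    have : σZ⁻¹ * (σZ * ρ) = 1 := by rw [key]; exact inv_mul_cancel σZ
    simpa using this
  -- back to covers
  have back : ∀ (σX σY : Equiv.Perm V) (l : Fin 5),
      (∃ ρ : Equiv.Perm V, (∀ i, ρ i = i ∨ ρ i = (σZ⁻¹ * σX) i ∨ ρ i = (σZ⁻¹ * σY) i) ∧ ρ (b 4) = b 4 ∧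
        ρ (b l) = σZ⁻¹ (b l) ∧ ρ (b 0) ≠ b 0) →
      ∃ T : Equiv.Perm V, (∀ i, T i = σX i ∨ T i = σY i ∨ T i = σZ i) ∧ T (b 4) = b 4 ∧ T (b l) = b l ∧ T (b 0) ≠ b 0 := by
    rintro σX σY l ⟨ρ, hρ, h4, hl, h0⟩
    refine ⟨σZ * ρ, fun i => ?_, by rw [Equiv.Perm.mul_apply, h4, hZ4], by rw [Equiv.Perm.mul_apply, hl]; simp, ?_⟩
    · rcases hρ i with h | h | h
      · right; right; rw [Equiv.Perm.mul_apply, h]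
      · left; rw [Equiv.Perm.mul_apply, h, rel]; simp
      · right; left; rw [Equiv.Perm.mul_apply, h, rel]; simp
    · rw [Equiv.Perm.mul_apply]
      intro h
      apply h0
      have e : σZ⁻¹ (b 0) = b 0 := by rw [Equiv.Perm.inv_eq_iff_eq, hZ0]
      exact (Equiv.Perm.eq_inv_iff_eq.mpr h).trans e
  have hne : ∀ l l' : Fin 5, l ≠ l' → b l ≠ b l' := fun l l' h e => h (hb e)
  have hz : ∀ l : Fin 5, ∀ l', σZ (b l') = b l' → b l ≠ b l' → σZ⁻¹ (b l) ≠ b l' := by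
    intro l l' hfix hne' h
    rw [Equiv.Perm.inv_eq_iff_eq, hfix] at h
    exact hne' h
  have hzz : ∀ l l' : Fin 5, l ≠ l' → σZ⁻¹ (b l) ≠ σZ⁻¹ (b l') := fun l l' h e => hne l l' h (σZ⁻¹.injective e)
  have hbz : ∀ l : Fin 5, σZ (b l) ≠ b l → b l ≠ σZ⁻¹ (b l) := fun l h e => h (by rw [Equiv.Perm.eq_inv_iff_eq] at e; exact e)
  rcases QCover.s3star α γ ε (b 0) (b 4) (b 1) (b 2) (b 3) (σZ⁻¹ (b 1)) (σZ⁻¹ (b 2)) (σZ⁻¹ (b 3))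
    (by rw [hα, rel, hB1]) (by rw [hγ, rel, hC1]) (by rw [hε, rel]; exact fun h => hE1 (σZ⁻¹.injective h))
    (by rw [hα, rel, hB2]) (by rw [hε, rel, hE2]) (by rw [hγ, rel]; exact fun h => hC2 (σZ⁻¹.injective h))
    (by rw [hγ, rel, hC3]) (by rw [hε, rel, hE3]) (by rw [hα, rel]; exact fun h => hB3 (σZ⁻¹.injective h))
    (by rw [hα, rel, ne_eq, Equiv.Perm.inv_eq_iff_eq, hZ0]; exact hB0)
    (by rw [hγ, rel, ne_eq, Equiv.Perm.inv_eq_iff_eq, hZ0]; exact hC0)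
    (by rw [hε, rel, ne_eq, Equiv.Perm.inv_eq_iff_eq, hZ0]; exact hE0)
    (hne 0 4 (by decide)) (hne 1 0 (by decide)) (hne 1 4 (by decide)) (hne 2 0 (by decide)) (hne 2 4 (by decide))
    (hne 3 0 (by decide)) (hne 3 4 (by decide))
    (hz 1 0 hZ0 (hne 1 0 (by decide))) (hz 1 4 hZ4 (hne 1 4 (by decide))) (hz 2 0 hZ0 (hne 2 0 (by decide)))
    (hz 2 4 hZ4 (hne 2 4 (by decide))) (hz 3 0 hZ0 (hne 3 0 (by decide))) (hz 3 4 hZ4 (hne 3 4 (by decide)))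
    (hne 1 2 (by decide)) (hne 1 3 (by decide)) (hne 2 3 (by decide))
    (hzz 1 2 (by decide)) (hzz 1 3 (by decide)) (hzz 2 3 (by decide)) (hbz 1 hZ1) (hbz 2 hZ2) (hbz 3 hZ3)
    (by rw [hα, hγ, hinv]; exact iBC) (by rw [hα, hε, hinv]; exact iBE) (by rw [hγ, hε, hinv]; exact iCE)
    (rigid σB σC uBC) (rigid σB σE uBE) (rigid σC σE uCE) with Q | Q | Q
  · exact Or.inl (back σB σC 1 Q)
  · exact Or.inr (Or.inl (back σB σE 2 Q))
  · exact Or.inr (Or.inr (back σC σE 3 Q))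

end Core

end Core
end MarkedEdge
end Summit.ValiantsHypothesis.ValiantsHypothesis.Theorems.KPlusLogSqLaw
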